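import Summits.Ventures.Crystal3D.Bulk.GapTightLevels
import HarnessLib

/-!
# Tight pairs are exposed edges of the hull of the thirteen directions (SCORE-DESIGN T2
# Lemma 16.1 "tight ⊂ Delaunay", supporting-functional form)

HONEST FRAMING. Part of the venture `Summits/Ventures/Crystal3D` (cell `pub-crystal3d`, phase 2,
24-hour sprint `PLAN.md` R42/R43; seat typer-bulk-2). The completeness lemma of a
TRIANGULATION-based census generator (Model T of `phase2/ENV-CENSUS/DESIGN-L12-THEORY.md`
§P-L4 A; `phase2/SCORE-DESIGN.md` §16 (theory-2), Lemma 16.1: "Let `(X,p)` be any pair with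
`ρ > 41.41° (= arccos ¾)`. Let `D` be ANY Delaunay triangulation of the 13 points `X ∪ {p}`.
Then every tight pair is an edge of `D`") in the kernel, in the elementary supporting-functional
form and for EVERY admissible fourteen-ball configuration (`IsGapConfig`) with
`intruderDist c < 3/2` (`= 2 cos ρ`, i.e. hole radius `ρ > arccos (3/4) = 41.41°` — exactly the
printed threshold; the census window has `D ≤ 1.26`):

* `IsGapConfig.inner_add_lt_of_tight` / `inner_add_eq_of_tight`: for a tight pair `{i, j}` the
  functional `⟪gapDir c i + gapDir c j, ·⟫` takes equal values at the two directions and a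
  strictly smaller value at every other of the thirteen directions (shell–shell contact: `3/2`
  against `≤ 1` at shell balls and `≤ D < 3/2` at the hole direction; shell–hole contact:
  `1 + D/2` against `≤ 1/2 + D/2`);
* `IsGapConfig.exists_exposing_functional_of_tight`: hence a hyperplane supports
  `conv {gapDir c k : k ≠ 0}` exactly along the segment `[gapDir c i, gapDir c j]` — the tight
  pair is an exposed EDGE of the hull polytope, i.e. an edge of the spherical Delaunay
  subdivision of the directions and of every Delaunay triangulation refining it;
* `IsGapConfig.weight_eq_zero_of_tight`: the same in convex-combination words (a convex
  combination of the directions reaching the supporting value has no weight off `{i, j}`).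

Pure inner-product algebra on top of `Bulk/GapTightLevels.lean`; nothing is claimed about
GAP(1.26), and the Delaunay subdivision itself (tree `ConvexHullFacets` / `SphericalCodeHull*`)
is not invoked.
-/

noncomputable section

open scoped BigOperators InnerProductSpace
open Finset Real

namespace Summit.Ventures.Crystal3D

/-! ## Tight pairs are exposed edges of the convex hull of the directions (T2 §16.1) -/

section HullEdge

variable {c : Fin 14 → EuclideanSpace ℝ (Fin 3)}

/-- **Tight pairs are exposed edges of the hull of the thirteen directions (SCORE-DESIGN T2
Lemma 16.1 "tight ⊂ Delaunay", supporting-functional form).** For every admissible configuration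
with `intruderDist c < 3/2` (hole radius `> arccos (3/4) = 41.41°`; the census window has
`D ≤ 1.26`) and every tight pair `{i, j}` of balls other than ball `0`, the linear functional
`⟪gapDir c i + gapDir c j, ·⟫` takes the SAME value at the two directions `gapDir c i`,
`gapDir c j` and a STRICTLY SMALLER value at every other direction `gapDir c k`. Hence the
segment `[gapDir c i, gapDir c j]` is an exposed edge of the polytope `conv {gapDir c k : k ≠ 0}`,
i.e. an edge of the spherical Delaunay subdivision of the thirteen directions, hence of EVERY
Delaunay triangulation (the completeness lemma of a triangulation-based generator, Model T of
DESIGN-L12-THEORY §P-L4 A / SCORE-DESIGN §16 (a)). Values: shell–shell contact `3/2` against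
`≤ 1` (other shell balls) and `≤ D < 3/2` (the hole direction); shell–hole contact `1 + D/2`
against `≤ 1/2 + D/2`. -/
theorem IsGapConfig.inner_add_lt_of_tight (hc : IsGapConfig c) (hD : intruderDist c < 3 / 2)
    {i j k : Fin 14} (hi0 : i ≠ 0) (hj0 : j ≠ 0) (hk0 : k ≠ 0) (hij : dist (c i) (c j) = 1)
    (hki : k ≠ i) (hkj : k ≠ j) :
    ⟪gapDir c i + gapDir c j, gapDir c k⟫_ℝ < ⟪gapDir c i + gapDir c j, gapDir c i⟫_ℝ := by
  have hD1 := hc.one_le_intruderDist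
  have hne := index_ne_of_dist_eq_one hij
  have hii : ⟪gapDir c i, gapDir c i⟫_ℝ = 1 := by
    rw [real_inner_self_eq_norm_sq, hc.norm_gapDir hi0]; norm_num
  have hij' := hc.inner_gapDir_eq hi0 hj0 hij
  have hik' := hc.inner_gapDir_le hi0 hk0 hki.symm
  have hjk' := hc.inner_gapDir_le hj0 hk0 hkj.symm
  rw [inner_add_left, inner_add_left, hii, real_inner_comm (gapDir c i) (gapDir c j), hij']
  -- case analysis on where the intruder is
  by_cases hk13 : k = 13
  · subst hk13
    have hi13 : i ≠ 13 := fun h => hki h.symm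
    have hj13 : j ≠ 13 := fun h => hkj h.symm
    rw [tightLevel_of_ne hi13 hj13]
    rw [tightLevel_of_right] at hik' hjk'
    linarith
  by_cases hi13 : i = 13
  · subst hi13
    have hj13 : j ≠ 13 := fun h => hne h.symm
    rw [tightLevel_of_left]
    rw [tightLevel_of_left] at hik'
    rw [tightLevel_of_ne hj13 hk13] at hjk'
    linarith
  by_cases hj13 : j = 13
  · subst hj13
    rw [tightLevel_of_right]
    rw [tightLevel_of_ne hi13 hk13] at hik'
    rw [tightLevel_of_left] at hjk'
    linarith
  · rw [tightLevel_of_ne hi13 hj13]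
    rw [tightLevel_of_ne hi13 hk13] at hik'
    rw [tightLevel_of_ne hj13 hk13] at hjk'
    linarith

/-- The supporting functional takes equal values at the two ends of a tight pair. -/
theorem IsGapConfig.inner_add_eq_of_tight (hc : IsGapConfig c) {i j : Fin 14} (hi0 : i ≠ 0)
    (hj0 : j ≠ 0) :
    ⟪gapDir c i + gapDir c j, gapDir c i⟫_ℝ = ⟪gapDir c i + gapDir c j, gapDir c j⟫_ℝ := by
  have hii : ⟪gapDir c i, gapDir c i⟫_ℝ = 1 := by
    rw [real_inner_self_eq_norm_sq, hc.norm_gapDir hi0]; norm_num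
  have hjj : ⟪gapDir c j, gapDir c j⟫_ℝ = 1 := by
    rw [real_inner_self_eq_norm_sq, hc.norm_gapDir hj0]; norm_num
  rw [inner_add_left, inner_add_left, hii, hjj, real_inner_comm (gapDir c j)]
  ring

/-- **T2 Lemma 16.1, exposed-edge form.** For every admissible configuration with
`intruderDist c < 3/2` and every tight pair `{i, j}` (`i, j ≠ 0`) there is a linear functional
on `ℝ³` maximised over the thirteen directions EXACTLY at `gapDir c i` and `gapDir c j`: the
segment between them is an exposed edge of `conv {gapDir c k : k ≠ 0}` (an edge of the
spherical Delaunay subdivision of the directions). -/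
theorem IsGapConfig.exists_exposing_functional_of_tight (hc : IsGapConfig c)
    (hD : intruderDist c < 3 / 2) {i j : Fin 14} (hi0 : i ≠ 0) (hj0 : j ≠ 0)
    (hij : dist (c i) (c j) = 1) :
    ∃ m : EuclideanSpace ℝ (Fin 3), ⟪m, gapDir c i⟫_ℝ = ⟪m, gapDir c j⟫_ℝ ∧
      ∀ k : Fin 14, k ≠ 0 → k ≠ i → k ≠ j → ⟪m, gapDir c k⟫_ℝ < ⟪m, gapDir c i⟫_ℝ :=
  ⟨gapDir c i + gapDir c j, hc.inner_add_eq_of_tight hi0 hj0,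
    fun _ hk0 hki hkj => hc.inner_add_lt_of_tight hD hi0 hj0 hk0 hij hki hkj⟩

/-- **In convex-hull words**: for a tight pair `{i, j}` no other direction lies in the closed
half-space `{y | ⟪gapDir c i + gapDir c j, y⟫ ≥ ⟪gapDir c i + gapDir c j, gapDir c i⟫}`, so
every point of `conv {gapDir c k : k ≠ 0}` on the supporting hyperplane is a convex combination
of `gapDir c i` and `gapDir c j` alone. Stated as: any convex combination of the directions
attaining the maximal value of the functional puts zero weight outside `{i, j}`. -/
theorem IsGapConfig.weight_eq_zero_of_tight (hc : IsGapConfig c) (hD : intruderDist c < 3 / 2)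
    {i j : Fin 14} (hi0 : i ≠ 0) (hj0 : j ≠ 0) (hij : dist (c i) (c j) = 1)
    (w : Fin 14 → ℝ) (hw0 : ∀ k, 0 ≤ w k) (hw00 : w 0 = 0) (hw1 : ∑ k, w k = 1)
    (hmax : ⟪gapDir c i + gapDir c j, gapDir c i⟫_ℝ ≤
      ⟪gapDir c i + gapDir c j, ∑ k, w k • gapDir c k⟫_ℝ) :
    ∀ k : Fin 14, k ≠ i → k ≠ j → w k = 0 := by
  set m := gapDir c i + gapDir c j with hm
  set M := ⟪m, gapDir c i⟫_ℝ with hM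
  have hle : ∀ k, w k * ⟪m, gapDir c k⟫_ℝ ≤ w k * M := by
    intro k
    by_cases hk0 : k = 0
    · rw [hk0, hw00, zero_mul, zero_mul]
    by_cases hki : k = i
    · rw [hki]
    by_cases hkj : k = j
    · rw [hkj, ← hc.inner_add_eq_of_tight hi0 hj0]
    exact mul_le_mul_of_nonneg_left (hc.inner_add_lt_of_tight hD hi0 hj0 hk0 hij hki hkj).le
      (hw0 k)
  have hsum : ⟪m, ∑ k, w k • gapDir c k⟫_ℝ = ∑ k, w k * ⟪m, gapDir c k⟫_ℝ := by
    rw [inner_sum]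
    refine Finset.sum_congr rfl fun k _ => ?_
    rw [real_inner_smul_right]
  have htot : ∑ k, w k * M = M := by rw [← Finset.sum_mul, hw1, one_mul]
  -- all the slack inequalities are equalities
  have heq : ∀ k ∈ (univ : Finset (Fin 14)), w k * ⟪m, gapDir c k⟫_ℝ = w k * M := by
    have h := (Finset.sum_eq_sum_iff_of_le fun k (_ : k ∈ univ) => hle k).1
    apply h
    apply le_antisymm (Finset.sum_le_sum fun k _ => hle k)
    rw [htot, ← hsum]; exact hmax
  intro k hki hkj
  by_cases hk0 : k = 0
  · rw [hk0, hw00]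
  have hlt := hc.inner_add_lt_of_tight hD hi0 hj0 hk0 hij hki hkj
  have hk := heq k (mem_univ k)
  by_contra hne
  have hpos : 0 < w k := lt_of_le_of_ne (hw0 k) (Ne.symm hne)
  have := mul_lt_mul_of_pos_left hlt hpos
  linarith

end HullEdge

end Summit.Ventures.Crystal3D
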